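import Summits.NavierStokesRegularity.NavierStokesRegularity.Theorems.TaoLadderRungTwoFlatHopTubeStatics
import HarnessLib

/-!
# HOP-INVARIANT-50 (image of record numT50/HopInvariant50.lean sha16 2e98d6c2d0715d3a, frozen for theory-1 g38), part 3 —
  the CLAMPED anchor algebra (entry-ratio amendment, SHARP deficit step) and the canonical ratio rule
  (cell harvest/h2-tao-ladder, theory-1 g38; landed by p1 g21 with declarations byte-identical under namespace
  `…Theorems.HopTube`; helper for item stmt-NavierStokesRegularity-23909 `GradedAdiabaticWake`)

Parts 1–2 (`…HopTube`, `…HopTubeStatics`) were landed from the earlier image 5ce486f7c5cf379d; the frozen image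
2e98d6c2d0715d3a differs from it there only in the import line and one docstring sentence, so they stand. This part and
`…HopTubeLanding` carry the sections that changed or were added since:

* `clampRatio` + `clampRatio_floor/_pos/_le_carrier`, `slack_clampRatio`, `carrier_div_clampRatio_le`,
  `min_le_carrier_div_clampRatio`, `anchorDeficit_step`, `carrier_div_clampRatio_eq` (an unclamped hop RESETS the
  deficit), `anchorDeficit_step_sharp` (shortfall against the FLOOR);
* `canonicalRule`, `tubeStepClock_canonical`, `anchor_upper_canonical`, `anchorDeficit_canonical`,
  `anchorClause_step_canonical`, `anchorClause_of_carrier_canonical` — `TubeStepClock` and the anchor band reduce to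
  ONE carrier inequality each.

HONEST FRAMING: MODEL lattice (graded mirror table on `S♭`); elementary algebra about the SHAPE of an induction
hypothesis; nothing certified; nothing about the Navier–Stokes equations.
-/

noncomputable section

set_option linter.dupNamespace false

namespace Summit.NavierStokesRegularity.NavierStokesRegularity.Theorems.HopTube

open Set Finset Literature.Analysis.FluidPDE Literature.Analysis.FluidPDE.TaoCascade
/-! ## Clamped anchor algebra (the ENTRY-RATIO amendment): the rule `a = max(f, s / A_*)`

With floor `f = (1+ε₀)^{-θ₀} ≤ 1`, landing carrier modulus `s = |S i₀ 1 τ₁|` and anchor `A = A_*`: the floor holds by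
construction; `a ≤ s` needs only `f ≤ s` and `A ≥ 1`; the slack `(1+σ)a ≤ s` needs only `(1+σ)f ≤ s` and `1+σ ≤ A`; the new
anchor coordinate `x' = (s/a)/A` lies in `[min 1 (x·R), 1]` when `s ≥ A·x·R` (`x` the old coordinate, `R` the state's intrinsic
one-hop carrier ratio), so the deficit obeys `1 - x' ≤ (1 - x) + max 0 (1 - R)` — clamped hops accumulate at most the ratio
shortfall, unclamped hops reset the deficit. Pure real algebra. -/

section Clamp

/-- The clamped ratio `max f (s / A)`. [cite: Tao2016AveragedNS, §6.4 (checkpoint ratio, statement shape); cell LADDER §50.7 (B)] -/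
def clampRatio (f s A : ℝ) : ℝ := max f (s / A)

/-- Floor by construction. [cite: Tao2016AveragedNS, §6.4; cell LADDER §50.7 (B)] -/
theorem clampRatio_floor (f s A : ℝ) : f ≤ clampRatio f s A := le_max_left _ _

/-- Positivity from a positive floor. [cite: Tao2016AveragedNS, §6.4; cell LADDER §50.7 (B)] -/
theorem clampRatio_pos {f : ℝ} (hf : 0 < f) (s A : ℝ) : 0 < clampRatio f s A :=
  hf.trans_le (le_max_left _ _)

/-- `a ≤ s` from `f ≤ s` and `A ≥ 1`. [cite: Tao2016AveragedNS, §6.4; cell LADDER §50.7 (B)] -/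
theorem clampRatio_le_carrier {f s A : ℝ} (hfs : f ≤ s) (hA : 1 ≤ A) (hs : 0 ≤ s) : clampRatio f s A ≤ s :=
  max_le hfs (div_le_self hs hA)

/-- Slack `(1+σ)·a ≤ s` from `(1+σ)f ≤ s` and `1+σ ≤ A`. [cite: Tao2016AveragedNS, §6.4; cell LADDER §50.7 (B)] -/
theorem slack_clampRatio {f s A σ : ℝ} (hσ : 0 < 1 + σ) (hfs : (1 + σ) * f ≤ s) (hA : 1 + σ ≤ A) (hs : 0 ≤ s) :
    (1 + σ) * clampRatio f s A ≤ s := by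
  have hA0 : 0 < A := hσ.trans_le hA
  unfold clampRatio
  rcases le_total f (s / A) with h | h
  · rw [max_eq_right h]
    have h1 : (1 + σ) / A ≤ 1 := by rwa [div_le_one hA0]
    calc (1 + σ) * (s / A) = s * ((1 + σ) / A) := by ring
      _ ≤ s * 1 := mul_le_mul_of_nonneg_left h1 hs
      _ = s := mul_one s
  · rw [max_eq_left h]; exact hfs

/-- The new anchor never exceeds `A`: `s / a ≤ A`. [cite: Tao2016AveragedNS, §6.4; cell LADDER §50.7 (B)] -/
theorem carrier_div_clampRatio_le {f s A : ℝ} (hf : 0 < f) (hA : 0 < A) :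
    s / clampRatio f s A ≤ A := by
  have hc : 0 < clampRatio f s A := clampRatio_pos hf s A
  rw [div_le_iff₀ hc]
  have h1 : s / A ≤ clampRatio f s A := le_max_right _ _
  calc s = A * (s / A) := by field_simp
    _ ≤ A * clampRatio f s A := mul_le_mul_of_nonneg_left h1 hA.le

/-- The new anchor is `A` when unclamped and at least `s` when clamped (`f ≤ 1`): `min A s ≤ s / a`.
[cite: Tao2016AveragedNS, §6.4; cell LADDER §50.7 (B)] -/
theorem min_le_carrier_div_clampRatio {f s A : ℝ} (hf : 0 < f) (hf1 : f ≤ 1) (hA : 0 < A) (hs : 0 ≤ s) :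
    min A s ≤ s / clampRatio f s A := by
  unfold clampRatio
  rcases le_total f (s / A) with h | h
  · rw [max_eq_right h]
    have hsA : 0 < s / A := hf.trans_le h
    have hs0 : 0 < s := by
      have := mul_pos hsA hA
      rwa [div_mul_cancel₀ s hA.ne'] at this
    have : s / (s / A) = A := by field_simp
    rw [this]; exact min_le_left _ _
  · rw [max_eq_left h]
    have h1 : s ≤ s / f := by rw [le_div_iff₀ hf]; exact mul_le_of_le_one_right hs hf1
    exact (min_le_right _ _).trans h1

/-- DEFICIT RECURSION: if the landing carrier is at least `A·x·R` (old anchor coordinate `x ∈ [0,1]`, intrinsic ratio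
`R ≥ 0`), the new coordinate `x' = (s/a)/A` satisfies `1 - x' ≤ (1 - x) + max 0 (1 - R)`.
[cite: Tao2016AveragedNS, §6.4; cell LADDER §50.7 (B)] -/
theorem anchorDeficit_step {f s A x R : ℝ} (hf : 0 < f) (hf1 : f ≤ 1) (hA : 0 < A) (hx0 : 0 ≤ x) (hx1 : x ≤ 1)
    (hR : 0 ≤ R) (hs : A * (x * R) ≤ s) :
    1 - s / clampRatio f s A / A ≤ (1 - x) + max 0 (1 - R) := by
  have hxR0 : 0 ≤ x * R := mul_nonneg hx0 hR
  have hs0 : 0 ≤ s := le_trans (by positivity) hs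
  have h1 := min_le_carrier_div_clampRatio hf hf1 hA hs0
  -- key: min 1 (x R) ≤ x'
  have key : min 1 (x * R) ≤ s / clampRatio f s A / A := by
    rw [le_div_iff₀ hA]
    rcases le_total 1 (x * R) with h | h
    · rw [min_eq_left h, one_mul]
      have hAs : A ≤ s := by nlinarith
      have : min A s = A := min_eq_left hAs
      rw [this] at h1; exact h1
    · rw [min_eq_right h]
      have h2 : A * (x * R) ≤ min A s := le_min (by nlinarith) hs
      linarith
  -- 1 - min 1 (xR) ≤ (1 - x) + max 0 (1 - R)
  have h3 : 1 - min 1 (x * R) ≤ (1 - x) + max 0 (1 - R) := by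
    rcases le_total 1 (x * R) with h | h
    · rw [min_eq_left h]
      have := le_max_left (0 : ℝ) (1 - R); linarith
    · rw [min_eq_right h]
      rcases le_total R 1 with hR1 | hR1
      · rw [max_eq_right (by linarith : (0 : ℝ) ≤ 1 - R)]
        nlinarith [mul_nonneg (by linarith : (0 : ℝ) ≤ 1 - x) (by linarith : (0 : ℝ) ≤ 1 - R)]
      · rw [max_eq_left (by linarith : (1 : ℝ) - R ≤ 0)]
        nlinarith [mul_le_mul_of_nonneg_left hR1 hx0]
  linarith

/-- The re-centred anchor in closed form: `s / clampRatio f s A = min (s/f) A` — dividing by the clamped ratio lands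
EXACTLY on `A` when unclamped and on `s/f < A` when clamped. [folklore] -/
theorem carrier_div_clampRatio_eq {f s A : ℝ} (hf : 0 < f) (hA : 0 < A) :
    s / clampRatio f s A = min (s / f) A := by
  unfold clampRatio
  by_cases h : s / A ≤ f
  · rw [max_eq_left h]
    have h' : s / f ≤ A := by
      rw [div_le_iff₀ hf]; rw [div_le_iff₀ hA] at h; linarith
    rw [min_eq_left h']
  · have hlt : f < s / A := lt_of_not_ge h
    rw [max_eq_right hlt.le]
    have hsA : 0 < s / A := hf.trans hlt
    have hs' : 0 < s := by
      have := mul_pos hsA hA; rwa [div_mul_cancel₀ _ hA.ne'] at this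
    have hA' : A ≤ s / f := by
      rw [le_div_iff₀ hf]; rw [lt_div_iff₀ hA] at hlt; linarith
    rw [min_eq_right hA']
    field_simp

/-- **SHARP one-hop deficit**: with `a := clampRatio f s A` and a carrier bound `s ≥ A·x·R`, the new deficit obeys
`1 − x′ ≤ (1 − x) + max 0 (1 − R/f)` — the shortfall is measured against the FLOOR `f`, not against `1`: once the
state's intrinsic ratio `R` exceeds the floor (steady regime: `a⋆(1 − Cδ_∞) ≥ (1+ε₀)^{−θ₀}` for small `ε₀`) the deficit
does not grow (and an unclamped hop resets it to `0`, `carrier_div_clampRatio_eq`), so the band schedule `γ` may be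
eventually constant. (The cruder `anchorDeficit_step`, shortfall `max 0 (1 − R)`, would force `γ ↑ ∞`.) [folklore] -/
theorem anchorDeficit_step_sharp {f s A x R : ℝ} (hf : 0 < f) (hA : 0 < A) (hx0 : 0 ≤ x) (hx1 : x ≤ 1)
    (hs : A * (x * R) ≤ s) :
    1 - s / clampRatio f s A / A ≤ (1 - x) + max 0 (1 - R / f) := by
  rw [carrier_div_clampRatio_eq hf hA]
  have hm0 : 0 ≤ max 0 (1 - R / f) := le_max_left _ _
  rcases le_total (s / f) A with h | h
  · rw [min_eq_left h]
    have hy : x * (R / f) ≤ s / f / A := by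
      rw [le_div_iff₀ hA, le_div_iff₀ hf]
      calc x * (R / f) * A * f = A * (x * (R / f * f)) := by ring
        _ = A * (x * R) := by rw [div_mul_cancel₀ R hf.ne']
        _ ≤ s := hs
    have h4 : x - x * (R / f) ≤ max 0 (1 - R / f) := by
      have e : x - x * (R / f) = x * (1 - R / f) := by ring
      rw [e]
      rcases le_total 0 (1 - R / f) with h5 | h5
      · exact le_trans (mul_le_of_le_one_left h5 hx1) (le_max_right _ _)
      · nlinarith [mul_nonneg hx0 (by linarith : (0 : ℝ) ≤ -(1 - R / f))]
    linarith
  · rw [min_eq_right h, div_self hA.ne']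
    linarith

end Clamp

/-! ## The canonical ratio rule and the reduction of `TubeStepClock` / the anchor band's upper edge to ONE
dynamical inequality: `(1+σ)(1+ε₀)^{-θ₀} ≤ |S i₀ 1 τ₁|` in the tube phase, `1+σ ≤ |S i₀ 1 τ₁|` in capture. -/

section Canonical

variable (P : TubeSchedule) (𝕊 : Finset (ℤ × ℤ × ℤ)) (σ ε₀ : ℝ) (i₀ : Fin 2)
  (α : Fin 2 → Fin 2 → Fin 2 → ℤ × ℤ × ℤ → ℝ) (X₀ : Fin 2 → ℝ) (w : ℤ → ℝ) (r θ₀ c₀ : ℝ)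
  (ζ : ℕ → Fin 2 → ℤ → ℝ) (ustar : Fin 2 → ℤ → ℝ)

/-- The CANONICAL ratio for a given section-time rule `τ₁`: `a = 1` in the capture phase (`n + 1 ≤ N₀`), the clamped
anchor normalisation `max((1+ε₀)^{-θ₀}, |S i₀ 1 τ₁| / A_*)` from the entry hop on.
[cite: Tao2016AveragedNS, §6.4 Prop. 6.5 (checkpoint ratio, statement shape); cell LADDER §50.7 (B)] -/
def canonicalRule (τ₁ : ℕ → (Fin 2 → ℤ → ℝ → ℝ) → ℝ) : HopRule where
  τ₁ := τ₁
  a := fun n S => if n + 1 ≤ P.N₀ then 1 else clampRatio ((1 + ε₀) ^ (-θ₀)) |S i₀ 1 (τ₁ n S)| P.Astar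

/-- **`TubeStepClock` FROM ONE CARRIER INEQUALITY** (canonical rule): given the section time inside the clock and
the landing-carrier lower bound `(1+σ)(1+ε₀)^{-θ₀} ≤ |S i₀ 1 τ₁|` (tube phase) / `1+σ ≤ |S i₀ 1 τ₁|` (capture
phase, child 1's headroom `(H)`), all six clock/ratio/slack conjuncts hold — floor and positivity by construction,
`a ≤ |S i₀ 1 τ₁|` and the slack by the clamped-anchor algebra (`1+σ ≤ A_*`).
[cite: Tao2016AveragedNS, §6.4 Prop. 6.5; cell TRANSFER-CONSTANTS §4; cell LADDER §50.7 (B)] -/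
theorem tubeStepClock_canonical (τ₁ : ℕ → (Fin 2 → ℤ → ℝ → ℝ) → ℝ) (n : ℕ)
    (hε : 0 ≤ ε₀) (hθ₀ : 0 ≤ θ₀) (hσ : 0 ≤ σ) (hσA : 1 + σ ≤ P.Astar)
    (hclock : ∀ z S₀ τ S F, HopPremise P 𝕊 ε₀ i₀ α X₀ w r c₀ ζ ustar n z S₀ τ S F →
      0 < τ₁ n S ∧ τ₁ n S ≤ c₀)
    (hcap : n + 1 ≤ P.N₀ → ∀ z S₀ τ S F, HopPremise P 𝕊 ε₀ i₀ α X₀ w r c₀ ζ ustar n z S₀ τ S F →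
      1 + σ ≤ |S i₀ 1 (τ₁ n S)|)
    (htube : P.N₀ ≤ n → ∀ z S₀ τ S F, HopPremise P 𝕊 ε₀ i₀ α X₀ w r c₀ ζ ustar n z S₀ τ S F →
      (1 + σ) * (1 + ε₀) ^ (-θ₀) ≤ |S i₀ 1 (τ₁ n S)|) :
    TubeStepClock P (canonicalRule P ε₀ i₀ θ₀ τ₁) 𝕊 σ ε₀ i₀ α X₀ w r θ₀ c₀ ζ ustar n := by
  intro z S₀ τ S F hP
  obtain ⟨h1, h2⟩ := hclock z S₀ τ S F hP
  have hf0 : 0 < (1 + ε₀) ^ (-θ₀) := Real.rpow_pos_of_pos (by linarith) _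
  have hf1 : (1 + ε₀) ^ (-θ₀) ≤ 1 :=
    Real.rpow_le_one_of_one_le_of_nonpos (by linarith) (by linarith)
  dsimp only [canonicalRule]
  refine ⟨h1, h2, ?_⟩
  by_cases hn : n + 1 ≤ P.N₀
  · rw [if_pos hn]
    have hc := hcap hn z S₀ τ S F hP
    exact ⟨one_pos, hf1, by linarith, by linarith⟩
  · have hn' : P.N₀ ≤ n := by omega
    rw [if_neg hn]
    have hs := htube hn' z S₀ τ S F hP
    have hs0 : 0 ≤ |S i₀ 1 (τ₁ n S)| := abs_nonneg _
    have hfs : (1 + ε₀) ^ (-θ₀) ≤ |S i₀ 1 (τ₁ n S)| := by nlinarith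
    exact ⟨clampRatio_pos hf0 _ _, clampRatio_floor _ _ _, clampRatio_le_carrier hfs (by linarith) hs0,
      slack_clampRatio (by linarith) hs hσA hs0⟩

/-- **UPPER EDGE OF THE ANCHOR BAND** (canonical rule, tube phase): the re-centred observable never exceeds `A_*`.
[cite: Tao2016AveragedNS, §6.4; cell LADDER §50.7 (B)] -/
theorem anchor_upper_canonical (τ₁ : ℕ → (Fin 2 → ℤ → ℝ → ℝ) → ℝ) {n : ℕ} (hn : P.N₀ ≤ n)
    (hε : 0 ≤ ε₀) (hA : 0 < P.Astar) (S : Fin 2 → ℤ → ℝ → ℝ) :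
    |recentre S (τ₁ n S) ((canonicalRule P ε₀ i₀ θ₀ τ₁).a n S) i₀ 0| ≤ P.Astar := by
  have hn' : ¬ (n + 1 ≤ P.N₀) := by omega
  have hf0 : 0 < (1 + ε₀) ^ (-θ₀) := Real.rpow_pos_of_pos (by linarith) _
  have hc : 0 < clampRatio ((1 + ε₀) ^ (-θ₀)) |S i₀ 1 (τ₁ n S)| P.Astar := clampRatio_pos hf0 _ _
  dsimp only [canonicalRule, recentre]
  rw [if_neg hn', add_zero, abs_div, abs_of_pos hc]
  exact carrier_div_clampRatio_le hf0 hA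

/-- **LOWER EDGE OF THE ANCHOR BAND, one hop** (canonical rule, tube phase): if the landing carrier is at least
`A_*·x·R` (`x` the state's anchor coordinate, `R ≥ 0` its intrinsic one-hop ratio) then the re-centred deficit obeys
`1 − |z′ i₀ 0|/A_* ≤ (1 − x) + max 0 (1 − R/(1+ε₀)^{−θ₀})` — shortfall against the FLOOR (sharp form: no growth
once `R` clears the floor). [cite: Tao2016AveragedNS, §6.4; cell LADDER §50.7 (B), §50.8] -/
theorem anchorDeficit_canonical (τ₁ : ℕ → (Fin 2 → ℤ → ℝ → ℝ) → ℝ) {n : ℕ} (hn : P.N₀ ≤ n)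
    (hε : 0 ≤ ε₀) (hA : 0 < P.Astar) (S : Fin 2 → ℤ → ℝ → ℝ) {x R : ℝ}
    (hx0 : 0 ≤ x) (hx1 : x ≤ 1) (hs : P.Astar * (x * R) ≤ |S i₀ 1 (τ₁ n S)|) :
    1 - |recentre S (τ₁ n S) ((canonicalRule P ε₀ i₀ θ₀ τ₁).a n S) i₀ 0| / P.Astar ≤
      (1 - x) + max 0 (1 - R / (1 + ε₀) ^ (-θ₀)) := by
  have hn' : ¬ (n + 1 ≤ P.N₀) := by omega
  have hf0 : 0 < (1 + ε₀) ^ (-θ₀) := Real.rpow_pos_of_pos (by linarith) _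
  have hc : 0 < clampRatio ((1 + ε₀) ^ (-θ₀)) |S i₀ 1 (τ₁ n S)| P.Astar := clampRatio_pos hf0 _ _
  dsimp only [canonicalRule, recentre]
  rw [if_neg hn', add_zero, abs_div, abs_of_pos hc]
  exact anchorDeficit_step_sharp hf0 hA hx0 hx1 hs

/-- **THE ANCHOR BAND IS INDUCTIVE** (canonical rule, tube phase): if `z` is banded at hop `n`, the landing carrier is
at least `A_*·x(z)·R` for some intrinsic ratio `R`, and the band schedule absorbs the shortfall AGAINST THE FLOOR
(`γ n + max 0 (1 − R/(1+ε₀)^{−θ₀}) ≤ γ (n+1)` — zero once `R` clears the floor, i.e. after the post-capture transient, so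
`γ` is eventually constant and `≤ Γ` ε₀-free), then the re-centred state is banded at hop `n + 1`. So `TubeStepAnchor`
reduces to the carrier lower bound, with `R = a⋆(1 − Cδ n − 2r)` from Core.
[cite: Tao2016AveragedNS, §6.4; cell LADDER §50.7 (B), §50.8] -/
theorem anchorClause_step_canonical (τ₁ : ℕ → (Fin 2 → ℤ → ℝ → ℝ) → ℝ) {n : ℕ} (hn : P.N₀ ≤ n)
    (hε : 0 ≤ ε₀) (hA : 0 < P.Astar) {z : Fin 2 → ℤ → ℝ} (hz : AnchorClause P i₀ n z)
    (S : Fin 2 → ℤ → ℝ → ℝ) {R : ℝ}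
    (hs : P.Astar * (anchorScale P i₀ z * R) ≤ |S i₀ 1 (τ₁ n S)|)
    (hγ : P.γ n + max 0 (1 - R / (1 + ε₀) ^ (-θ₀)) ≤ P.γ (n + 1)) :
    AnchorClause P i₀ (n + 1) (recentre S (τ₁ n S) ((canonicalRule P ε₀ i₀ θ₀ τ₁).a n S)) := by
  have hx0 : 0 ≤ anchorScale P i₀ z := by unfold anchorScale; positivity
  have hx1 : anchorScale P i₀ z ≤ 1 := by
    unfold anchorScale; rw [div_le_one hA]; exact hz.2
  have hxγ : 1 - anchorScale P i₀ z ≤ P.γ n := by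
    have h := hz.1
    unfold anchorScale
    rw [sub_le_iff_le_add, ← sub_le_iff_le_add', le_div_iff₀ hA]
    linarith
  refine ⟨?_, anchor_upper_canonical P ε₀ i₀ θ₀ τ₁ hn hε hA S⟩
  have hd := anchorDeficit_canonical P ε₀ i₀ θ₀ τ₁ hn hε hA S hx0 hx1 hs
  -- 1 - |z'|/A ≤ γ (n+1)  ⇒  A (1 - γ (n+1)) ≤ |z'|
  have h1 : 1 - |recentre S (τ₁ n S) ((canonicalRule P ε₀ i₀ θ₀ τ₁).a n S) i₀ 0| / P.Astar ≤ P.γ (n + 1) := by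
    linarith
  have h2 : 1 - P.γ (n + 1) ≤ |recentre S (τ₁ n S) ((canonicalRule P ε₀ i₀ θ₀ τ₁).a n S) i₀ 0| / P.Astar := by
    linarith
  rw [le_div_iff₀ hA] at h2
  linarith

/-- **ANCHOR BAND FROM A BARE CARRIER BOUND** (canonical rule, any hop landing in the tube phase — in particular the
ENTRY hop `n = N₀`, where no band at `n` is available): if `|S i₀ 1 τ₁| ≥ A_*(1 − γ (n+1))·(1+ε₀)^{−θ₀}` then the
re-centred state is banded at `n + 1` (re-centred anchor `= min (s/(1+ε₀)^{−θ₀}) A_*`, `carrier_div_clampRatio_eq`).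
[cite: Tao2016AveragedNS, §6.4; cell LADDER §50.8] -/
theorem anchorClause_of_carrier_canonical (τ₁ : ℕ → (Fin 2 → ℤ → ℝ → ℝ) → ℝ) {n : ℕ} (hn : P.N₀ ≤ n)
    (hε : 0 ≤ ε₀) (hA : 0 < P.Astar) (S : Fin 2 → ℤ → ℝ → ℝ) (hγ0 : 0 ≤ P.γ (n + 1))
    (hs : P.Astar * (1 - P.γ (n + 1)) * (1 + ε₀) ^ (-θ₀) ≤ |S i₀ 1 (τ₁ n S)|) :
    AnchorClause P i₀ (n + 1) (recentre S (τ₁ n S) ((canonicalRule P ε₀ i₀ θ₀ τ₁).a n S)) := by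
  have hn' : ¬ (n + 1 ≤ P.N₀) := by omega
  have hf0 : 0 < (1 + ε₀) ^ (-θ₀) := Real.rpow_pos_of_pos (by linarith) _
  have hc : 0 < clampRatio ((1 + ε₀) ^ (-θ₀)) |S i₀ 1 (τ₁ n S)| P.Astar := clampRatio_pos hf0 _ _
  unfold AnchorClause
  dsimp only [canonicalRule, recentre]
  rw [if_neg hn', add_zero, abs_div, abs_of_pos hc, carrier_div_clampRatio_eq hf0 hA]
  refine ⟨le_min ?_ ?_, min_le_right _ _⟩
  · rw [le_div_iff₀ hf0]; exact hs
  · nlinarith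

end Canonical

end Summit.NavierStokesRegularity.NavierStokesRegularity.Theorems.HopTube

end
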